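import Mathlib.Algebra.Order.Floor.Defs
import Mathlib.Algebra.BigOperators.Fin
import Mathlib.Data.Int.Interval
import Mathlib.Data.Rat.Floor
import Mathlib.Tactic
import HarnessLib

/-!
# The basic arithmetic holonomy bound, I: the counting lemmas of the dynamic box principle

Calegari–Dimitrov–Tang, *The linear independence of `1`, `ζ(2)`, and `L(2,χ₋₃)`*
(arXiv:2408.15403), **Appendix §17 "A dynamic box principle"** (pp. 129–130), prove the basic
arithmetic holonomy bound
`m ≤ 2·sup_𝕋 log max(|u|,|v|) / (log|φ'(0)| − b₁ − ⋯ − b_r)` (eq. (PZ final); with Nevanlinna's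
lemma, eq. (basic basic) `m ≤ 2T(φ)/(log|φ'(0)| − Σ bᵢ)`) by a *dynamic box principle* after
Perelli–Zannier: the `T^{mD}` auxiliary functions `F = Σ Qᵢ fᵢ` (`Qᵢ ∈ ℤ[x]_{<D}` with
coefficients in `[0,T)`) are counted through the tree of their Taylor coefficients at the `mD`
"vanishing filtration jumps" `u(1) < ⋯ < u(mD)`: `#𝒪_D ≤ Π_p γ_p`, where `γ_p` bounds the
number of possible `x^{u(p)}`-coefficients given the preceding ones (§17.2), and each `γ_p` is a
count of points of the lattice `(1/N)ℤ` (`N` = the denominator type at `u(p)`) in an interval of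
length `2A_p` coming from Cauchy's estimate (§17.3): `γ_p = 1 + 2A_p·N`.

This file proves the two purely combinatorial counting facts of §17.2, in the generality used:

* `HolonomyBound.card_le_prod_of_forall_card_image_le` — **tree counting**: a finite set
  `S` of functions `Fin k → α` in which, for every `p` and every prefix, at most `γ p` values
  occur at position `p` among the members sharing that prefix, has `#S ≤ Π_p γ p`.
* `HolonomyBound.card_le_of_den_dvd_of_diam_le` — **lattice points in an interval**: a finite
  set of rationals with denominators dividing `N` and diameter `≤ A` has at most `A·N + 1`
  elements (so a fortiori `≤ 1 + 2A·N`, the printed `γ_p`).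

The linear algebra of the filtration jumps (§17.1), the analytic estimate (§17.3) and the
assembly of the bound are in the sequel files. No named facts (everything here is proved).

## References

* [CalegariDimitrovTang2024] arXiv:2408.15403, Appendix §17, §§17.1–17.2 (pp. 129–130).
* A. Perelli, U. Zannier, *On recurrent mod `p` sequences*, J. reine angew. Math. 348 (1984)
  (the dynamic box principle, Lemma 1), as cited there.
-/

open Finset

namespace Literature.NumberTheory.Transcendental

namespace HolonomyBound

/-! ### Tree counting -/

section TreeCounting

variable {α : Type*} [DecidableEq α]

/-- The members of `S` sharing the prefix of `s` strictly below position `p`. [folklore] -/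
def samePrefix {k : ℕ} (S : Finset (Fin k → α)) (s : Fin k → α) (p : Fin k) :
    Finset (Fin k → α) :=
  S.filter fun t => ∀ q : Fin k, q < p → t q = s q

/-- Membership in `samePrefix`. [folklore] -/
theorem mem_samePrefix {k : ℕ} {S : Finset (Fin k → α)} {s t : Fin k → α} {p : Fin k} :
    t ∈ samePrefix S s p ↔ t ∈ S ∧ ∀ q : Fin k, q < p → t q = s q := by
  simp [samePrefix]

/-- **Tree counting** (the combinatorial core of the dynamic box principle, CDT §17.2
"`#𝒪_D ≤ Π_{p=1}^{mD} γ_p`"): let `S` be a finite set of functions `Fin k → α` such that for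
every position `p` and every `s ∈ S`, the members of `S` that agree with `s` at all positions
`< p` take at most `γ p` distinct values at position `p`. Then `#S ≤ Π_p γ p`. (Induction on
`k`: project away the last coordinate; each fibre has at most `γ (last)` elements.)
[cite: CalegariDimitrovTang2024, Appendix §17.2 (p. 130)] -/
theorem card_le_prod_of_forall_card_image_le :
    ∀ {k : ℕ} (S : Finset (Fin k → α)) (γ : Fin k → ℕ),
      (∀ (p : Fin k) (s : Fin k → α), s ∈ S →
        ((samePrefix S s p).image fun t => t p).card ≤ γ p) →
      S.card ≤ ∏ p, γ p := by
  intro k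
  induction k with
  | zero =>
    intro S γ _
    -- at most one function `Fin 0 → α`
    rw [Finset.univ_eq_empty, Finset.prod_empty]
    exact Finset.card_le_one.mpr fun a _ b _ => funext fun i => Fin.elim0 i
  | succ k ih =>
    intro S γ hS
    -- project to the first `k` coordinates
    let π : (Fin (k + 1) → α) → (Fin k → α) := fun t => t ∘ Fin.castSucc
    set S' : Finset (Fin k → α) := S.image π with hS'
    -- the projected set satisfies the hypothesis with `γ ∘ castSucc`
    have hS'hyp : ∀ (p : Fin k) (s' : Fin k → α), s' ∈ S' →
        ((samePrefix S' s' p).image fun t => t p).card ≤ γ (Fin.castSucc p) := by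
      intro p s' hs'
      obtain ⟨s, hs, rfl⟩ := Finset.mem_image.mp hs'
      refine le_trans (Finset.card_le_card ?_) (hS (Fin.castSucc p) s hs)
      intro x hx
      obtain ⟨t', ht', rfl⟩ := Finset.mem_image.mp hx
      obtain ⟨ht'S', ht'pre⟩ := mem_samePrefix.mp ht'
      obtain ⟨t, ht, rfl⟩ := Finset.mem_image.mp ht'S'
      refine Finset.mem_image.mpr ⟨t, mem_samePrefix.mpr ⟨ht, fun q hq => ?_⟩, rfl⟩
      -- `q < castSucc p`, so `q = castSucc q'` with `q' < p`
      have hqk : (q : ℕ) < k := by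
        have h1 : (q : ℕ) < (Fin.castSucc p : ℕ) := Fin.lt_def.mp hq
        have h2 : ((Fin.castSucc p : Fin (k + 1)) : ℕ) = (p : ℕ) := Fin.val_castSucc p
        have h3 := p.isLt
        omega
      have hq' : q = Fin.castSucc ⟨q, hqk⟩ := Fin.ext rfl
      rw [hq']
      have := ht'pre ⟨q, hqk⟩ (by rw [Fin.lt_def] at hq ⊢; exact hq)
      exact this
    have hcardS' : S'.card ≤ ∏ p : Fin k, γ (Fin.castSucc p) :=
      ih S' (fun p => γ (Fin.castSucc p)) hS'hyp
    -- each fibre of the projection has at most `γ (last k)` elements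
    have hfib : ∀ s' ∈ S', (S.filter fun t => π t = s').card ≤ γ (Fin.last k) := by
      intro s' hs'
      obtain ⟨s, hs, rfl⟩ := Finset.mem_image.mp hs'
      -- the fibre is contained in `samePrefix S s (last k)` and is determined by the last value
      have hsub : (S.filter fun t => π t = π s) ⊆ samePrefix S s (Fin.last k) := by
        intro t ht
        rw [Finset.mem_filter] at ht
        refine mem_samePrefix.mpr ⟨ht.1, fun q hq => ?_⟩
        have hqk : (q : ℕ) < k := by
          have := Fin.lt_def.mp hq
          simpa using this
        have : t (Fin.castSucc ⟨q, hqk⟩) = s (Fin.castSucc ⟨q, hqk⟩) := congr_fun ht.2 ⟨q, hqk⟩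
        have hq' : q = Fin.castSucc ⟨q, hqk⟩ := Fin.ext rfl
        rw [hq']
        exact this
      have hinj : Set.InjOn (fun t : Fin (k + 1) → α => t (Fin.last k))
          (S.filter fun t => π t = π s) := by
        intro t₁ ht₁ t₂ ht₂ hlast
        rw [Finset.mem_coe, Finset.mem_filter] at ht₁ ht₂
        funext i
        rcases Fin.eq_castSucc_or_eq_last i with ⟨i', rfl⟩ | rfl
        · have h1 : t₁ (Fin.castSucc i') = s (Fin.castSucc i') := congr_fun ht₁.2 i'
          have h2 : t₂ (Fin.castSucc i') = s (Fin.castSucc i') := congr_fun ht₂.2 i'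
          rw [h1, h2]
        · exact hlast
      calc (S.filter fun t => π t = π s).card
          = ((S.filter fun t => π t = π s).image fun t => t (Fin.last k)).card :=
            (Finset.card_image_of_injOn hinj).symm
        _ ≤ ((samePrefix S s (Fin.last k)).image fun t => t (Fin.last k)).card :=
            Finset.card_le_card (Finset.image_subset_image hsub)
        _ ≤ γ (Fin.last k) := hS (Fin.last k) s hs
    -- count along the fibres
    calc S.card = ∑ s' ∈ S', (S.filter fun t => π t = s').card :=
          Finset.card_eq_sum_card_image π S
      _ ≤ ∑ _s' ∈ S', γ (Fin.last k) := Finset.sum_le_sum hfib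
      _ = S'.card * γ (Fin.last k) := by rw [Finset.sum_const, smul_eq_mul]
      _ ≤ (∏ p : Fin k, γ (Fin.castSucc p)) * γ (Fin.last k) :=
          Nat.mul_le_mul_right _ hcardS'
      _ = ∏ p, γ p := (Fin.prod_univ_castSucc γ).symm

end TreeCounting

/-! ### Lattice points of `(1/N)ℤ` in a short interval -/

/-- **Points of `(1/N)ℤ` in an interval** (the count behind CDT's
`γ_p = 1 + 2A_p·[1,…,b₁u(p)]⋯[1,…,b_r u(p)]`, §17.2): a finite set of rational numbers whose
denominators divide `N ≥ 1`, any two of which differ by at most `A ≥ 0`, has at most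
`2A·N + 1` elements (the numerators are integers in an interval `[z₀ − AN, z₀ + AN]`).
[cite: CalegariDimitrovTang2024, Appendix §17.2, the bound `γ_p` (p. 130)] -/
theorem card_le_of_den_dvd_of_diam_le (S : Finset ℚ) {N : ℕ} (hN : 0 < N) {A : ℝ}
    (hA : 0 ≤ A) (hden : ∀ β ∈ S, ∃ z : ℤ, (β : ℚ) = z / N)
    (hdiam : ∀ β ∈ S, ∀ β' ∈ S, |((β : ℚ) : ℝ) - β'| ≤ A) :
    (S.card : ℝ) ≤ 2 * A * N + 1 := by
  rcases S.eq_empty_or_nonempty with rfl | hne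
  · simp only [Finset.card_empty, Nat.cast_zero]
    positivity
  · choose! z hz using hden
    obtain ⟨β₀, hβ₀⟩ := hne
    have hNr : (0 : ℝ) < N := by exact_mod_cast hN
    set L : ℤ := ⌊A * N⌋ with hL
    have hL0 : 0 ≤ L := Int.floor_nonneg.mpr (by positivity)
    -- numerators lie in an integer interval of length `2L`
    have hmem : ∀ β ∈ S, z β ∈ Finset.Icc (z β₀ - L) (z β₀ + L) := by
      intro β hβ
      have hd := hdiam β hβ β₀ hβ₀
      rw [hz β hβ, hz β₀ hβ₀] at hd
      push_cast at hd
      rw [← sub_div, abs_div, abs_of_pos hNr, div_le_iff₀ hNr] at hd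
      -- `|z β - z β₀| ≤ A N`, an integer bound
      have hint : |z β - z β₀| ≤ L := by
        rw [hL, Int.le_floor]
        push_cast
        exact hd
      rw [Finset.mem_Icc]
      constructor <;> linarith [abs_le.mp hint]
    have hinj : Set.InjOn z (S : Set ℚ) := by
      intro β hβ β' hβ' h
      rw [Finset.mem_coe] at hβ hβ'
      rw [hz β hβ, hz β' hβ', h]
    have hcard : S.card ≤ (Finset.Icc (z β₀ - L) (z β₀ + L)).card :=
      Finset.card_le_card_of_injOn z hmem hinj
    rw [Int.card_Icc] at hcard
    have htoNat : (((z β₀ + L + 1 - (z β₀ - L)).toNat : ℕ) : ℤ) = 2 * L + 1 := by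
      rw [Int.toNat_of_nonneg (by omega)]
      ring
    have hcardZ : (S.card : ℤ) ≤ 2 * L + 1 := by
      rw [← htoNat]
      exact_mod_cast hcard
    have hcardR : (S.card : ℝ) ≤ 2 * (L : ℝ) + 1 := by exact_mod_cast hcardZ
    have hLle : (L : ℝ) ≤ A * N := Int.floor_le _
    linarith

end HolonomyBound

end Literature.NumberTheory.Transcendental
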